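import Literature.NumberTheory.Automorphic.MatrixTwoConjugacy
import Literature.NumberTheory.Automorphic.QuaternionConjugacy
import Mathlib.FieldTheory.Minpoly.Field
import Mathlib.RingTheory.Ideal.Quotient.Operations
import HarnessLib

/-!
# Matching the regular classes of `D^×` with the elliptic classes of `GL(2)`: `K(γ') ≅ K(γ)`
(Gelbart, *Automorphic forms on adele groups* (1975), p. 150: "for each `E_v` choose an imbedding of
`E_v` in `M(2, F_v)` and `D_v` … by the theorem of Skolem–Noether this imbedding is uniquely
determined up to inner automorphism"; pp. 154–155, (10.17)–(10.18): the classes on both sides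
indexed by quadratic extensions `E`; Jacquet–Langlands, LNM 114, §16)

Topic `NumberTheory/Automorphic`. Definitions (`aevalAdjoin`, `adjoinCongrOfMinpolyEq`,
`quaternionGlTwoAdjoinEquiv`, `quaternionGlTwoCentralizerEquiv`) and theorems; no named fact, no
instance.

In the comparison of the trace formulas (10.14) for `D^×` and (10.15) for `GL(2)` the elliptic
terms are matched class by class: a non-central `γ' ∈ D` and an elliptic `γ ∈ M₂(K)` correspond
when they have the same characteristic polynomial, `(trd γ', nrd γ') = (tr γ, det γ)`; then the
quadratic algebras `K(γ') = C_D(γ') ⊆ D` and `K(γ) = C_{M₂(K)}(γ) ⊆ M₂(K)` are isomorphic (both are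
`K[X]/(X² - tX + n)`), and this isomorphism carries the torus of `γ'` to the torus of `γ`
(their adelic points, `ℝ_{>0}`-parts and covolumes then correspond by `AdelicUnitsCongr`,
`QuaternionTorusCentralizer`, `GLTwoTorusVolume`). This file supplies the algebra:

* `aevalAdjoin K x : K[X] →ₐ[K] K[x]` (evaluation onto the subalgebra generated by `x`, surjective),
  `ker_aevalAdjoin` (`= ker(aeval x) = (minpoly x)`);
* `adjoinCongrOfMinpolyEq` — **for elements `x ∈ B`, `y ∈ C` of two `K`-algebras with the same
  minimal polynomial, `K[x] ≃ₐ[K] K[y]` with `x ↦ y`** (`adjoinCongrOfMinpolyEq_apply_aevalAdjoin`,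
  `adjoinCongrOfMinpolyEq_gen`): `K[x] ≅ K[X]/ker ≅ K[y]` by the first isomorphism theorem
  (Mathlib `Ideal.quotientKerAlgEquivOfSurjective`, `Ideal.quotientEquivAlgOfEq`);
* `minpoly_eq_of_quaternion`, `minpoly_eq_charpoly_of_irreducible` — for a quaternion algebra `D`
  over `K` (char. `0`) and `γ' ∈ D`, if `X² - trd(γ') X + nrd(γ')` is irreducible then it is the
  minimal polynomial of `γ'` (`γ'² = trd γ' · γ' - nrd γ'`); for `γ ∈ M₂(K)` with irreducible
  characteristic polynomial, `minpoly γ = charpoly γ = X² - tr(γ) X + det(γ)`;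
* `quaternionGlTwoAdjoinEquiv` — **`K[γ'] ≃ₐ[K] K[γ]`, `γ' ↦ γ`, whenever `trd γ' = tr γ`,
  `nrd γ' = det γ` and `γ` is elliptic**; `quaternionGlTwoCentralizerEquiv` — the same between the
  centraliser subalgebras `C_D(γ') ≃ₐ[K] C_{M₂(K)}(γ)` (the types of the tori `T = C_D(γ')`,
  `E = C_{M₂(K)}(γ)` in `QuaternionAdelicTorus`, `GLTwoAdelicTorus`) for a division `D`
  (`Subalgebra.centralizer_singleton_eq_adjoin`, `centralizer_singleton_eq_adjoin_of_not_mem_bot`);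
* `not_mem_bot_of_irreducible_quadratic` — such a `γ'` is not central; `exists_glTwo_of_trace_det`
  — every pair `(t, n)` with `n ≠ 0` is `(tr γ, det γ)` for some `γ ∈ GL₂(K)` (the companion
  matrix), so every regular class of `D^×` has a partner class in `GL₂(K)` (Gelbart (10.18):
  `Q' ⊆ Q`).

A brick of the inline (D-0026) decomposition of
`Literature.NumberTheory.Automorphic.strong_multiplicity_one_quaternionUnits` (Gelbart Thm. 10.5).

## References

* S. Gelbart, *Automorphic forms on adele groups*, Ann. of Math. Studies 83 (1975), p. 150,
  pp. 154–155 [Gelbart1975].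
* H. Jacquet, R. P. Langlands, *Automorphic forms on GL(2)*, LNM 114 (1970), §16
  [JacquetLanglands1970].
* M.-F. Vignéras, *Arithmétique des algèbres de quaternions*, LNM 800 (1980), Ch. I §1–§2
  [VignerasLNM800].
-/

noncomputable section

open Polynomial Matrix

namespace Literature.NumberTheory.Automorphic

/-! ### `K[x] ≅ K[y]` for elements with the same minimal polynomial -/

section AdjoinCongr

variable (K : Type*) [Field K] {B : Type*} [Ring B] [Algebra K B] {C : Type*} [Ring C] [Algebra K C]

/-- Evaluation `K[X] → K[x]` onto the subalgebra generated by `x` (`Polynomial.aeval x` with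
codomain restricted to its range `Algebra.adjoin K {x}`). [folklore] -/
def aevalAdjoin (x : B) : K[X] →ₐ[K] Algebra.adjoin K {x} :=
  (Polynomial.aeval x).codRestrict (Algebra.adjoin K {x}) fun p => by
    rw [Algebra.adjoin_singleton_eq_range_aeval]; exact ⟨p, rfl⟩

/-- `aevalAdjoin x p = aeval x p` in `B`. [folklore] -/
@[simp]
theorem coe_aevalAdjoin (x : B) (p : K[X]) : (aevalAdjoin K x p : B) = Polynomial.aeval x p := rfl

/-- `aevalAdjoin x` is onto `K[x]`. [folklore] -/
theorem aevalAdjoin_surjective (x : B) : Function.Surjective (aevalAdjoin K x) := by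
  rintro ⟨b, hb⟩
  rw [Algebra.adjoin_singleton_eq_range_aeval] at hb
  obtain ⟨p, rfl⟩ := hb
  exact ⟨p, rfl⟩

/-- `aevalAdjoin x X = x`. [folklore] -/
theorem aevalAdjoin_X (x : B) :
    aevalAdjoin K x Polynomial.X = ⟨x, Algebra.self_mem_adjoin_singleton K x⟩ :=
  Subtype.ext (Polynomial.aeval_X x)

/-- The kernel of `aevalAdjoin x` is the kernel of `aeval x`, i.e. the ideal of the minimal
polynomial. [folklore] -/
theorem ker_aevalAdjoin (x : B) :
    RingHom.ker (aevalAdjoin K x) = RingHom.ker (Polynomial.aeval x : K[X] →ₐ[K] B) := by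
  ext p
  rw [RingHom.mem_ker, RingHom.mem_ker]
  constructor
  · intro h
    exact congrArg Subtype.val h
  · intro h
    exact Subtype.ext h

/-- Elements with the same minimal polynomial have the same evaluation kernel. [folklore] -/
theorem ker_aevalAdjoin_eq_of_minpoly_eq {x : B} {y : C} (h : minpoly K x = minpoly K y) :
    RingHom.ker (aevalAdjoin K x) = RingHom.ker (aevalAdjoin K y) := by
  rw [ker_aevalAdjoin, ker_aevalAdjoin, minpoly.ker_aeval_eq_span_minpoly,
    minpoly.ker_aeval_eq_span_minpoly, h]

/-- **`K[x] ≃ₐ[K] K[y]` for elements of two `K`-algebras with the same minimal polynomial**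
(`K[x] ≅ K[X] / (minpoly) ≅ K[y]`, first isomorphism theorem). For quadratic elements of a
quaternion algebra and of `M₂(K)` this is the isomorphism `K(γ') ≅ K(γ)` behind Gelbart's
indexing of the classes on both sides of (10.14) = (10.15) by quadratic extensions (p. 154).
[folklore] -/
def adjoinCongrOfMinpolyEq (x : B) (y : C) (h : minpoly K x = minpoly K y) :
    Algebra.adjoin K {x} ≃ₐ[K] Algebra.adjoin K {y} :=
  (Ideal.quotientKerAlgEquivOfSurjective (aevalAdjoin_surjective K x)).symm.trans
    ((Ideal.quotientEquivAlgOfEq K (ker_aevalAdjoin_eq_of_minpoly_eq K h)).trans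
      (Ideal.quotientKerAlgEquivOfSurjective (aevalAdjoin_surjective K y)))

/-- `adjoinCongrOfMinpolyEq` maps `p(x)` to `p(y)`. [folklore] -/
@[simp]
theorem adjoinCongrOfMinpolyEq_apply_aevalAdjoin (x : B) (y : C) (h : minpoly K x = minpoly K y)
    (p : K[X]) :
    adjoinCongrOfMinpolyEq K x y h (aevalAdjoin K x p) = aevalAdjoin K y p := by
  simp [adjoinCongrOfMinpolyEq]

/-- `adjoinCongrOfMinpolyEq` maps `x` to `y`. [folklore] -/
theorem adjoinCongrOfMinpolyEq_gen (x : B) (y : C) (h : minpoly K x = minpoly K y) :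
    adjoinCongrOfMinpolyEq K x y h ⟨x, Algebra.self_mem_adjoin_singleton K x⟩ =
      ⟨y, Algebra.self_mem_adjoin_singleton K y⟩ := by
  rw [← aevalAdjoin_X K x, adjoinCongrOfMinpolyEq_apply_aevalAdjoin, aevalAdjoin_X]

/-- On underlying elements: `adjoinCongrOfMinpolyEq (p(x)) = p(y)`. [folklore] -/
theorem coe_adjoinCongrOfMinpolyEq_aeval (x : B) (y : C) (h : minpoly K x = minpoly K y) (p : K[X]) :
    ((adjoinCongrOfMinpolyEq K x y h (aevalAdjoin K x p) : Algebra.adjoin K {y}) : C) =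
      Polynomial.aeval y p := by
  rw [adjoinCongrOfMinpolyEq_apply_aevalAdjoin, coe_aevalAdjoin]

end AdjoinCongr

/-! ### Minimal polynomials of quadratic elements -/

section Minpoly

variable (K : Type*) [Field K]

/-- An element whose (irreducible) quadratic relation has no root is not central: if
`X² - t X + n` is irreducible over `K` and `a² = t a - n` in a `K`-algebra `B`, then `a ∉ K`.
[folklore] -/
theorem not_mem_bot_of_irreducible_quadratic {B : Type*} [Ring B] [Algebra K B] [Nontrivial B]
    {t n : K} (hirr : Irreducible (X ^ 2 - C t * X + C n : K[X])) {a : B}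
    (ha : Polynomial.aeval a (X ^ 2 - C t * X + C n : K[X]) = 0) :
    a ∉ (⊥ : Subalgebra K B) := by
  intro h
  obtain ⟨c, rfl⟩ := Algebra.mem_bot.1 h
  have hroot : (X ^ 2 - C t * X + C n : K[X]).IsRoot c := by
    rw [Polynomial.aeval_algebraMap_apply_eq_algebraMap_eval] at ha
    exact (algebraMap K B).injective (by rw [ha, map_zero])
  have h1 := Polynomial.degree_eq_one_of_irreducible_of_root hirr hroot
  have h2 : (X ^ 2 - C t * X + C n : K[X]).degree = 2 := by
    compute_degree!
  rw [h2] at h1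
  exact absurd h1 (by decide)

/-- **The minimal polynomial of a quadratic element of a quaternion algebra**: for `γ' ∈ D`
(`D` quaternion over `K`, char. `0`) with `X² - trd(γ') X + nrd(γ')` irreducible over `K`, this
polynomial is `minpoly K γ'` (it is monic, kills `γ'` by `γ'² = trd γ' · γ' - nrd γ'`
(`mul_self_eq_reducedTrace_mul_sub_reducedNorm`), and is irreducible; Vignéras I §1 Lemme 1.1).
[cite: VignerasLNM800, Ch. I §1 Lemme 1.1] -/
theorem minpoly_eq_of_quaternion (D : Type*) [Ring D] [Algebra K D] [CharZero K]
    [IsQuaternionAlgebra K D] (γ' : D)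
    (hirr : Irreducible (X ^ 2 - C (reducedTrace K D γ') * X + C (reducedNorm K D γ') : K[X])) :
    minpoly K γ' = X ^ 2 - C (reducedTrace K D γ') * X + C (reducedNorm K D γ') := by
  haveI : Nontrivial D := Module.nontrivial_of_finrank_pos (R := K)
    (by rw [IsQuaternionAlgebra.finrank_eq_four (K := K) (D := D)]; omega)
  refine (minpoly.eq_of_irreducible_of_monic hirr ?_ ?_).symm
  · have h := mul_self_eq_reducedTrace_mul_sub_reducedNorm K D γ'
    simp only [map_add, map_sub, map_mul, Polynomial.aeval_C, Polynomial.aeval_X, pow_two]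
    rw [h]
    abel
  · have : (X ^ 2 - C (reducedTrace K D γ') * X + C (reducedNorm K D γ') : K[X]).Monic := by
      monicity!
    exact this

/-- The quadratic relation of a quaternion: `aeval γ' (X² - trd X + nrd) = 0`. [cite: VignerasLNM800, Ch. I §1 Lemme 1.1] -/
theorem aeval_quadratic_eq_zero_of_quaternion (D : Type*) [Ring D] [Algebra K D] [CharZero K]
    [IsQuaternionAlgebra K D] (γ' : D) :
    Polynomial.aeval γ' (X ^ 2 - C (reducedTrace K D γ') * X + C (reducedNorm K D γ') : K[X]) = 0 := by
  have h := mul_self_eq_reducedTrace_mul_sub_reducedNorm K D γ'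
  simp only [map_add, map_sub, map_mul, Polynomial.aeval_C, Polynomial.aeval_X, pow_two]
  rw [h]
  abel

/-- **The minimal polynomial of an elliptic `γ ∈ M₂(K)` is its characteristic polynomial**
`X² - tr(γ) X + det(γ)` (Cayley–Hamilton, `Matrix.aeval_self_charpoly`, and irreducibility).
[folklore] -/
theorem minpoly_eq_charpoly_of_irreducible {γ : Matrix (Fin 2) (Fin 2) K} (hγ : Irreducible γ.charpoly) :
    minpoly K γ = γ.charpoly :=
  (minpoly.eq_of_irreducible_of_monic hγ (Matrix.aeval_self_charpoly γ) γ.charpoly_monic).symm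

end Minpoly

/-! ### `K(γ') ≅ K(γ)` for matching classes of `D^×` and `GL₂(K)` -/

section Matching

variable (K : Type*) (D : Type*) [Field K] [Ring D] [Algebra K D] [CharZero K] [IsQuaternionAlgebra K D]

omit [CharZero K] [IsQuaternionAlgebra K D] in
/-- The matching condition transported to polynomials: if `trd γ' = tr γ` and `nrd γ' = det γ` then
the quadratic polynomial of `γ'` is the characteristic polynomial of `γ`. [folklore] -/
theorem quadratic_eq_charpoly_of_trace_det {γ' : D} {γ : Matrix (Fin 2) (Fin 2) K}
    (ht : reducedTrace K D γ' = γ.trace) (hn : reducedNorm K D γ' = γ.det) :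
    (X ^ 2 - C (reducedTrace K D γ') * X + C (reducedNorm K D γ') : K[X]) = γ.charpoly := by
  rw [Matrix.charpoly_fin_two, ht, hn]

/-- Matching elements have the same minimal polynomial. [folklore] -/
theorem minpoly_eq_of_trace_det {γ' : D} {γ : Matrix (Fin 2) (Fin 2) K}
    (hγ : Irreducible γ.charpoly) (ht : reducedTrace K D γ' = γ.trace) (hn : reducedNorm K D γ' = γ.det) :
    minpoly K γ' = minpoly K γ := by
  have hq := quadratic_eq_charpoly_of_trace_det K D ht hn
  rw [minpoly_eq_charpoly_of_irreducible K hγ, minpoly_eq_of_quaternion K D γ' (hq ▸ hγ), hq]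

/-- A quaternion matching an elliptic `γ ∈ M₂(K)` is not central. [folklore] -/
theorem not_mem_bot_of_trace_det {γ' : D} {γ : Matrix (Fin 2) (Fin 2) K}
    (hγ : Irreducible γ.charpoly) (ht : reducedTrace K D γ' = γ.trace) (hn : reducedNorm K D γ' = γ.det) :
    γ' ∉ (⊥ : Subalgebra K D) := by
  haveI : Nontrivial D := Module.nontrivial_of_finrank_pos (R := K)
    (by rw [IsQuaternionAlgebra.finrank_eq_four (K := K) (D := D)]; omega)
  have hq := quadratic_eq_charpoly_of_trace_det K D ht hn
  exact not_mem_bot_of_irreducible_quadratic K (hq ▸ hγ) (aeval_quadratic_eq_zero_of_quaternion K D γ')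

/-- **`K[γ'] ≃ₐ[K] K[γ]`, `γ' ↦ γ`, for a quaternion `γ'` and an elliptic `γ ∈ M₂(K)` with
`trd γ' = tr γ`, `nrd γ' = det γ`** (both are `K[X]/(X² - tX + n)`; Gelbart (1975), p. 150 and
p. 154: one quadratic extension `E` embedded in `D` and in `M(2, K)`). [cite: Gelbart1975, pp. 150, 154] -/
def quaternionGlTwoAdjoinEquiv (γ' : D) (γ : Matrix (Fin 2) (Fin 2) K) (hγ : Irreducible γ.charpoly)
    (ht : reducedTrace K D γ' = γ.trace) (hn : reducedNorm K D γ' = γ.det) :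
    Algebra.adjoin K {γ'} ≃ₐ[K] Algebra.adjoin K {γ} :=
  adjoinCongrOfMinpolyEq K γ' γ (minpoly_eq_of_trace_det K D hγ ht hn)

/-- `quaternionGlTwoAdjoinEquiv` maps `γ'` to `γ`. [cite: Gelbart1975, pp. 150, 154] -/
theorem quaternionGlTwoAdjoinEquiv_gen (γ' : D) (γ : Matrix (Fin 2) (Fin 2) K)
    (hγ : Irreducible γ.charpoly) (ht : reducedTrace K D γ' = γ.trace) (hn : reducedNorm K D γ' = γ.det) :
    quaternionGlTwoAdjoinEquiv K D γ' γ hγ ht hn ⟨γ', Algebra.self_mem_adjoin_singleton K γ'⟩ =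
      ⟨γ, Algebra.self_mem_adjoin_singleton K γ⟩ :=
  adjoinCongrOfMinpolyEq_gen K γ' γ _

/-- **The tori correspond: `C_D(γ') ≃ₐ[K] C_{M₂(K)}(γ)`, `γ' ↦ γ`**, for a *division* quaternion
algebra `D`, `γ' ∈ D` and an elliptic `γ ∈ M₂(K)` with `trd γ' = tr γ`, `nrd γ' = det γ` — the
types `T = C_D(γ')`, `E = C_{M₂(K)}(γ)` of the adelic tori of `QuaternionAdelicTorus` and
`GLTwoAdelicTorus` (`C_D(γ') = K[γ']`, `Subalgebra.centralizer_singleton_eq_adjoin`;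
`C_{M₂(K)}(γ) = K[γ]`, `centralizer_singleton_eq_adjoin_of_not_mem_bot`). Gelbart (1975), p. 154:
`B'_F = B_F(E)` in `G'_F` and `B_F = B_F(E)` in `G_F`. [cite: Gelbart1975, p. 154] -/
def quaternionGlTwoCentralizerEquiv (hD : ∀ x : D, x ≠ 0 → IsUnit x) (γ' : D) (γ : Matrix (Fin 2) (Fin 2) K)
    (hγ : Irreducible γ.charpoly) (ht : reducedTrace K D γ' = γ.trace) (hn : reducedNorm K D γ' = γ.det) :
    Subalgebra.centralizer K ({γ'} : Set D) ≃ₐ[K]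
      Subalgebra.centralizer K ({γ} : Set (Matrix (Fin 2) (Fin 2) K)) :=
  (Subalgebra.equivOfEq _ _ (Subalgebra.centralizer_singleton_eq_adjoin hD
      (IsQuaternionAlgebra.finrank_eq_four (K := K) (D := D)) (not_mem_bot_of_trace_det K D hγ ht hn))).trans
    ((quaternionGlTwoAdjoinEquiv K D γ' γ hγ ht hn).trans
      (Subalgebra.equivOfEq _ _
        (centralizer_singleton_eq_adjoin_of_not_mem_bot (not_mem_bot_of_irreducible_charpoly hγ)).symm))

/-- `quaternionGlTwoCentralizerEquiv` on underlying elements is `quaternionGlTwoAdjoinEquiv`.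
[folklore] -/
theorem coe_quaternionGlTwoCentralizerEquiv (hD : ∀ x : D, x ≠ 0 → IsUnit x) (γ' : D)
    (γ : Matrix (Fin 2) (Fin 2) K) (hγ : Irreducible γ.charpoly) (ht : reducedTrace K D γ' = γ.trace)
    (hn : reducedNorm K D γ' = γ.det) (z : Subalgebra.centralizer K ({γ'} : Set D)) :
    ((quaternionGlTwoCentralizerEquiv K D hD γ' γ hγ ht hn z :
        Subalgebra.centralizer K ({γ} : Set (Matrix (Fin 2) (Fin 2) K))) : Matrix (Fin 2) (Fin 2) K) =
      ((quaternionGlTwoAdjoinEquiv K D γ' γ hγ ht hn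
        ⟨z, by
          rw [← Subalgebra.centralizer_singleton_eq_adjoin hD
            (IsQuaternionAlgebra.finrank_eq_four (K := K) (D := D)) (not_mem_bot_of_trace_det K D hγ ht hn)]
          exact z.2⟩ : Algebra.adjoin K {γ}) : Matrix (Fin 2) (Fin 2) K) := rfl

/-- `quaternionGlTwoCentralizerEquiv` maps `γ'` to `γ`. [cite: Gelbart1975, p. 154] -/
theorem coe_quaternionGlTwoCentralizerEquiv_gen (hD : ∀ x : D, x ≠ 0 → IsUnit x) (γ' : D)
    (γ : Matrix (Fin 2) (Fin 2) K) (hγ : Irreducible γ.charpoly) (ht : reducedTrace K D γ' = γ.trace)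
    (hn : reducedNorm K D γ' = γ.det) (hγ'mem : γ' ∈ Subalgebra.centralizer K ({γ'} : Set D)) :
    ((quaternionGlTwoCentralizerEquiv K D hD γ' γ hγ ht hn ⟨γ', hγ'mem⟩ :
        Subalgebra.centralizer K ({γ} : Set (Matrix (Fin 2) (Fin 2) K))) : Matrix (Fin 2) (Fin 2) K) = γ := by
  have h := quaternionGlTwoAdjoinEquiv_gen K D γ' γ hγ ht hn
  have h' := congrArg (fun z : Algebra.adjoin K {γ} => (z : Matrix (Fin 2) (Fin 2) K)) h
  simp only at h'
  rw [coe_quaternionGlTwoCentralizerEquiv]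
  exact h'

/-! ### Every regular class of `D^×` has a partner class in `GL₂(K)` -/

omit [CharZero K] [IsQuaternionAlgebra K D] in
/-- **The companion matrix realises every characteristic polynomial**: for `t, n ∈ K` with
`n ≠ 0`, `γ = !![0, -n; 1, t] ∈ GL₂(K)` has `tr γ = t`, `det γ = n`. So the map
`(regular classes of Dˣ) → (elliptic classes of GL₂(K))`, `[γ'] ↦ [γ]` with
`(tr, det)(γ) = (trd, nrd)(γ')`, is defined on every class (Gelbart (10.18): `Q' ⊆ Q`); it is
well defined and injective on classes by `isConj_iff_reducedTrace_eq_and_reducedNorm_eq`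
(`QuaternionConjugacy`) and `isConj_iff_of_irreducible_charpoly` (`MatrixTwoConjugacy`).
[cite: Gelbart1975, pp. 154–155] -/
theorem exists_glTwo_of_trace_det (t n : K) (hn : n ≠ 0) :
    ∃ γ : GL (Fin 2) K, (γ : Matrix (Fin 2) (Fin 2) K).trace = t ∧ (γ : Matrix (Fin 2) (Fin 2) K).det = n := by
  have hdet : (!![0, -n; 1, t] : Matrix (Fin 2) (Fin 2) K).det = n := by
    simp [Matrix.det_fin_two]
  have hu : IsUnit (!![0, -n; 1, t] : Matrix (Fin 2) (Fin 2) K) := by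
    rw [Matrix.isUnit_iff_isUnit_det, hdet]
    exact isUnit_iff_ne_zero.mpr hn
  refine ⟨hu.unit, ?_, ?_⟩
  · rw [IsUnit.unit_spec]
    simp [Matrix.trace_fin_two]
  · rw [IsUnit.unit_spec, hdet]

/-- The reduced norm of a unit of a quaternion algebra is non-zero (`isUnit_iff_reducedNorm_ne_zero`),
so `exists_glTwo_of_trace_det` applies to `(trd γ', nrd γ')` for every `γ' ∈ Dˣ`. [cite: VignerasLNM800, Ch. I §1] -/
theorem exists_glTwo_of_units (γ' : Dˣ) :
    ∃ γ : GL (Fin 2) K, (γ : Matrix (Fin 2) (Fin 2) K).trace = reducedTrace K D (γ' : D) ∧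
      (γ : Matrix (Fin 2) (Fin 2) K).det = reducedNorm K D (γ' : D) :=
  exists_glTwo_of_trace_det K _ _ ((isUnit_iff_reducedNorm_ne_zero_holds K D (γ' : D)).1 γ'.isUnit)

end Matching

end Literature.NumberTheory.Automorphic
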